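import Mathlib.RingTheory.PowerSeries.Derivative
import Mathlib.Analysis.Complex.Polynomial.Basic
import Literature.NumberTheory.LFunctions.WeilConjectures
import HarnessLib

/-!
# The Hasse–Weil bound for curves from a Weil factorization (family RH, discharge of rh.S37's
curve clause)

This file proves `Literature.NumberTheory.LFunctions.abs_pointCount_sub_le_of_curve` (stated in
`Literature/NumberTheory/LFunctions/WeilConjectures.lean`) outright, as
`Literature.NumberTheory.LFunctions.abs_pointCount_sub_le_of_curve_holds`: the fact is conditional on a Weil factorization
`Z(X, T) = P₁(T)/((1 - T)(1 - qT))` satisfying the Riemann hypothesis, and the bound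
`|#X(𝔽_{q^m}) - qᵐ - 1| ≤ deg P₁ · q^{m/2}` follows from it by taking the logarithmic derivative of
`Z = exp (∑ N_m Tᵐ/m)` in `ℂ⟦T⟧` (Hartshorne, *Algebraic Geometry*, App. C, Ex. 5.7 (a), (b)).

## Sources

* A. Weil, *Sur les courbes algébriques et les variétés qui s'en déduisent* (1948) — the theorem.
* R. Hartshorne, *Algebraic Geometry*, App. C, Ex. 5.7 (a), (b) — this implication.

## Design notes

* Kept in a sibling file so that the statement file does not acquire the imports
  `Mathlib.RingTheory.PowerSeries.Derivative` and `Mathlib.Analysis.Complex.Polynomial.Basic`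
  (fundamental theorem of algebra, `Complex.isAlgClosed`).
* Only Mathlib's formal power series calculus (`PowerSeries.derivative`, `derivative_subst`,
  `derivative_exp`, inverses over a field) and `Polynomial.Splits` are used; the smoothness
  hypothesis of the fact is not needed for this implication.
-/

universe u

open Polynomial

/-! ## Proof of the Hasse–Weil bound

Hartshorne, *Algebraic Geometry*, App. C, Ex. 5.7 (a), (b): from
`Z(T) · (1 - T)(1 - qT) = P₁(T)`, `Z = exp L`, `L = ∑_{m ≥ 1} N_m Tᵐ / m`, one takes the logarithmic
derivative in `ℂ⟦T⟧`. Writing `P₁ = c ∏_z (T - z)` over `ℂ` (fundamental theorem of algebra; the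
roots `z` are the inverses of the usual `αⱼ`, and `|z| = q^{-1/2}` by the Riemann hypothesis part of
`IsWeilFactorization`), `L' + (1 - T)'/(1 - T) + (1 - qT)'/(1 - qT) = P₁'/P₁ = ∑_z 1/(T - z)`, and
comparing the coefficients of `Tⁿ` gives `N_{n+1} - 1 - q^{n+1} = -∑_z z^{-(n+1)}`, whence
`|N_{n+1} - q^{n+1} - 1| ≤ deg P₁ · q^{(n+1)/2}`. Names below are qualified (`PowerSeries.X`,
`PowerSeries.C`) because `Polynomial` is open in this file.
-/

noncomputable section

namespace Literature.NumberTheory.LFunctions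

section RH

/-! ### Formal power series lemmas -/

namespace HasseWeil

open scoped PowerSeries

variable {F : Type*} [Field F]

/-- The formal derivative `d⁄dX` commutes with a change of coefficient ring
(coefficientwise: `[Tⁿ] f' = (n + 1) [Tⁿ⁺¹] f`). [folklore] -/
theorem derivative_map {R S : Type*} [CommSemiring R] [CommSemiring S] (φ : R →+* S)
    (f : R⟦X⟧) : d⁄dX S (PowerSeries.map φ f) = PowerSeries.map φ (d⁄dX R f) := by
  ext n
  simp [PowerSeries.coeff_derivative, PowerSeries.coeff_map]

/-- Additivity of the logarithmic derivative `f ↦ f' · f⁻¹` on `F⟦T⟧` (`F` a field) for series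
with non-zero constant term: `(fg)'/(fg) = f'/f + g'/g`. [folklore] -/
theorem derivative_mul_mul_inv {f g : F⟦X⟧} (hf : PowerSeries.constantCoeff f ≠ 0)
    (hg : PowerSeries.constantCoeff g ≠ 0) :
    d⁄dX F (f * g) * (f * g)⁻¹ = d⁄dX F f * f⁻¹ + d⁄dX F g * g⁻¹ := by
  rw [Derivation.leibniz, PowerSeries.mul_inv_rev, smul_eq_mul, smul_eq_mul]
  linear_combination (d⁄dX F g * g⁻¹) * PowerSeries.mul_inv_cancel f hf +
    (d⁄dX F f * f⁻¹) * PowerSeries.mul_inv_cancel g hg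

/-- The logarithmic derivative of a finite product of series with non-zero constant terms is the
sum of the logarithmic derivatives. [folklore] -/
theorem derivative_prod_mul_inv (s : Multiset F⟦X⟧)
    (hs : ∀ f ∈ s, PowerSeries.constantCoeff f ≠ 0) :
    d⁄dX F s.prod * s.prod⁻¹ = (s.map fun f => d⁄dX F f * f⁻¹).sum := by
  induction s using Multiset.induction_on with
  | empty => simp
  | cons a s ih =>
    have hs' : ∀ f ∈ s, PowerSeries.constantCoeff f ≠ 0 :=
      fun f hf => hs f (Multiset.mem_cons_of_mem hf)
    have hprod : PowerSeries.constantCoeff s.prod ≠ 0 := by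
      rw [map_multiset_prod]
      refine Multiset.prod_ne_zero fun h => ?_
      obtain ⟨f, hf, h0⟩ := Multiset.mem_map.mp h
      exact hs' f hf h0
    rw [Multiset.prod_cons, Multiset.map_cons, Multiset.sum_cons,
      derivative_mul_mul_inv (hs a (Multiset.mem_cons_self a s)) hprod, ih hs']

/-- Geometric series: `1/(T - z) = -∑ₙ z^{-(n+1)} Tⁿ` in `F⟦T⟧` for `z ≠ 0`. [folklore] -/
theorem inv_X_sub_C {z : F} (hz : z ≠ 0) :
    (PowerSeries.X - PowerSeries.C z)⁻¹ = PowerSeries.mk fun n => -(z⁻¹ ^ (n + 1)) := by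
  rw [PowerSeries.inv_eq_iff_mul_eq_one (by simpa using hz)]
  ext n
  cases n with
  | zero => simp [mul_sub, hz]
  | succ n =>
    simp only [mul_sub, map_sub, PowerSeries.coeff_succ_mul_X, PowerSeries.coeff_mk,
      PowerSeries.coeff_mul_C, PowerSeries.coeff_one]
    simp [pow_succ, hz]

/-- `[Tⁿ] (T - z)'/(T - z) = -z^{-(n+1)}` for `z ≠ 0`. [folklore] -/
theorem coeff_derivative_X_sub_C_mul_inv {z : F} (hz : z ≠ 0) (n : ℕ) :
    PowerSeries.coeff n (d⁄dX F (PowerSeries.X - PowerSeries.C z) *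
      (PowerSeries.X - PowerSeries.C z)⁻¹) = -(z⁻¹ ^ (n + 1)) := by
  rw [map_sub, PowerSeries.derivative_X, PowerSeries.derivative_C, sub_zero, one_mul,
    inv_X_sub_C hz, PowerSeries.coeff_mk]

/-- Geometric series: `1/(1 - aT) = ∑ₙ aⁿ Tⁿ` in `F⟦T⟧`. [folklore] -/
theorem inv_one_sub_C_mul_X (a : F) :
    (1 - PowerSeries.C a * PowerSeries.X)⁻¹ = PowerSeries.mk fun n => a ^ n := by
  rw [PowerSeries.inv_eq_iff_mul_eq_one (by simp)]
  ext n
  cases n with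
  | zero => simp [mul_sub]
  | succ n =>
    simp only [mul_sub, mul_one, ← mul_assoc, map_sub, PowerSeries.coeff_succ_mul_X,
      PowerSeries.coeff_mk, PowerSeries.coeff_mul_C, PowerSeries.coeff_one]
    simp [pow_succ]

/-- `(1 - aT)' = -a` in `F⟦T⟧`. [folklore] -/
theorem derivative_one_sub_C_mul_X (a : F) :
    d⁄dX F (1 - PowerSeries.C a * PowerSeries.X) = -PowerSeries.C a := by
  rw [map_sub, Derivation.map_one_eq_zero, zero_sub, Derivation.leibniz, PowerSeries.derivative_X,
    PowerSeries.derivative_C, smul_zero, add_zero, smul_eq_mul, mul_one]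

/-- `[Tⁿ] (1 - aT)'/(1 - aT) = -aⁿ⁺¹`. [folklore] -/
theorem coeff_derivative_one_sub_C_mul_X_mul_inv (a : F) (n : ℕ) :
    PowerSeries.coeff n (d⁄dX F (1 - PowerSeries.C a * PowerSeries.X) *
      (1 - PowerSeries.C a * PowerSeries.X)⁻¹) = -(a ^ (n + 1)) := by
  rw [derivative_one_sub_C_mul_X, inv_one_sub_C_mul_X, neg_mul, map_neg, PowerSeries.coeff_C_mul,
    PowerSeries.coeff_mk, pow_succ']

/-- `[Tⁿ] (1 - T)'/(1 - T) = -1`. [folklore] -/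
theorem coeff_derivative_one_sub_X_mul_inv (n : ℕ) :
    PowerSeries.coeff n (d⁄dX F (1 - PowerSeries.X) * (1 - PowerSeries.X)⁻¹) = -1 := by
  simpa using coeff_derivative_one_sub_C_mul_X_mul_inv (1 : F) n

/-- The polynomial-to-power-series coercion of a product of linear factors `∏ (T - z)`.
[folklore] -/
theorem coe_multiset_prod_X_sub_C (s : Multiset F) :
    (((s.map fun z => X - C z).prod : F[X]) : F⟦X⟧) =
      (s.map fun z => PowerSeries.X - PowerSeries.C z).prod := by
  rw [← Polynomial.coeToPowerSeries.ringHom_apply, map_multiset_prod, Multiset.map_map]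
  refine congr_arg _ (Multiset.map_congr rfl fun z _ => ?_)
  simp

/-- Logarithmic derivative of a split polynomial `p = c ∏_z (T - z)` with `p(0) ≠ 0`, as a power
series: `p'/p = ∑_z 1/(T - z)`, i.e. `[Tⁿ] p'/p = -∑_z z^{-(n+1)}` (sum over the roots with
multiplicity; Hartshorne, App. C, Ex. 5.7 (a), "taking logs"). [folklore] -/
theorem coeff_derivative_coe_mul_inv {p : F[X]} (hp : p.Splits) (h0 : p.coeff 0 ≠ 0) (n : ℕ) :
    PowerSeries.coeff n (d⁄dX F (p : F⟦X⟧) * (p : F⟦X⟧)⁻¹) =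
      -(p.roots.map fun z => z⁻¹ ^ (n + 1)).sum := by
  have hp0 : p ≠ 0 := fun h => h0 (by simp [h])
  have hlc : p.leadingCoeff ≠ 0 := leadingCoeff_ne_zero.mpr hp0
  have hz : ∀ z ∈ p.roots, z ≠ 0 := by
    intro z hz h
    subst h
    exact h0 (by simpa [coeff_zero_eq_eval_zero] using ((mem_roots hp0).mp hz))
  have hp' : (p : F⟦X⟧) = PowerSeries.C p.leadingCoeff *
      (p.roots.map fun z => PowerSeries.X - PowerSeries.C z).prod := by
    conv_lhs => rw [hp.eq_prod_roots]
    rw [Polynomial.coe_mul, Polynomial.coe_C, coe_multiset_prod_X_sub_C]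
  have hfac : ∀ f ∈ p.roots.map (fun z => PowerSeries.X - PowerSeries.C z),
      PowerSeries.constantCoeff f ≠ 0 := by
    intro f hf
    obtain ⟨z, hzr, rfl⟩ := Multiset.mem_map.mp hf
    simpa using hz z hzr
  have hprod : PowerSeries.constantCoeff
      (p.roots.map fun z => PowerSeries.X - PowerSeries.C z).prod ≠ 0 := by
    rw [map_multiset_prod]
    refine Multiset.prod_ne_zero fun h => ?_
    obtain ⟨f, hf, h0⟩ := Multiset.mem_map.mp h
    exact hfac f hf h0
  rw [hp', derivative_mul_mul_inv (by simpa using hlc) hprod, PowerSeries.derivative_C, zero_mul,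
    zero_add, derivative_prod_mul_inv _ hfac, Multiset.map_map, map_multiset_sum, Multiset.map_map,
    ← Multiset.sum_map_neg]
  refine congr_arg _ (Multiset.map_congr rfl fun z hzr => ?_)
  exact coeff_derivative_X_sub_C_mul_inv (hz z hzr) n

/-! ### The dimension-one Weil factorization -/

/-- Unpacking `IsWeilFactorization q 1 Z P`: `Z · (1 - T)(1 - qT) = P₁` in `ℚ⟦T⟧`
(Hartshorne, App. C, Thm. 1.3 for `n = 1`: `P₀ = 1 - T`, `P₂ = 1 - qT`). [folklore] -/
theorem mul_eq_of_isWeilFactorization_one {q : ℕ} {Z : PowerSeries ℚ}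
    {P : Fin (2 * 1 + 1) → ℤ[X]} (hW : Literature.AlgebraicGeometry.Motives.IsWeilFactorization q 1 Z P) :
    Z * ((1 - PowerSeries.X) * (1 - PowerSeries.C (q : ℚ) * PowerSeries.X)) =
      ((P 1).map (Int.castRingHom ℚ) : PowerSeries ℚ) := by
  obtain ⟨-, hZ, hP0, hP2, -⟩ := hW
  have heven : (Finset.univ : Finset (Fin (2 * 1 + 1))).filter (fun i => Even i.val) = {0, 2} := by
    decide
  have hodd : (Finset.univ : Finset (Fin (2 * 1 + 1))).filter (fun i => Odd i.val) = {1} := by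
    decide
  rw [heven, hodd, Finset.prod_pair (by decide), Finset.prod_singleton, hP0,
    show (2 : Fin (2 * 1 + 1)) = Fin.last (2 * 1) from rfl, hP2] at hZ
  simp only [Polynomial.map_sub, Polynomial.map_one, Polynomial.map_mul, Polynomial.map_X,
    Polynomial.map_C] at hZ
  simp only [Polynomial.coe_sub, Polynomial.coe_one, Polynomial.coe_mul, Polynomial.coe_X,
    Polynomial.coe_C] at hZ
  simpa only [map_pow, pow_one, eq_intCast, Int.cast_natCast] using hZ

/-- The key identity (Hartshorne, App. C, Ex. 5.7 (a)): if `Z ∈ ℚ⟦T⟧` satisfies `Z' = Z · D` and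
admits a Weil factorization `(P₀, P₁, P₂)` in dimension `1`, then for every `n`,
`[Tⁿ] D - qⁿ⁺¹ - 1 = -∑_z z^{-(n+1)}` in `ℂ`, the sum running over the complex roots `z` of `P₁`
with multiplicity (the `z⁻¹` are the reciprocal roots `αⱼ` of `P₁ = ∏ⱼ (1 - αⱼT)`).
[cite: Hartshorne1977, App. C, Ex. 5.7(a)] -/
theorem coeff_sub_eq_neg_sum_roots {q : ℕ} {Z D : PowerSeries ℚ} {P : Fin (2 * 1 + 1) → ℤ[X]}
    (hW : Literature.AlgebraicGeometry.Motives.IsWeilFactorization q 1 Z P) (hD : d⁄dX ℚ Z = Z * D) (n : ℕ) :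
    ((PowerSeries.coeff n D : ℚ) : ℂ) - (q : ℂ) ^ (n + 1) - 1 =
      -(((P 1).map (Int.castRingHom ℂ)).roots.map fun z => z⁻¹ ^ (n + 1)).sum := by
  set φ : ℚ →+* ℂ := algebraMap ℚ ℂ with hφ
  set A : ℂ[X] := (P 1).map (Int.castRingHom ℂ) with hA
  have hA0 : A.coeff 0 = 1 := by simp [hA, hW.1 1]
  have hAc : PowerSeries.map φ (((P 1).map (Int.castRingHom ℚ) : ℚ[X]) : ℚ⟦X⟧) = (A : ℂ⟦X⟧) := by
    ext m
    simp [hA, hφ, Polynomial.coeff_coe]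
  -- the factorization, base-changed to `ℂ⟦T⟧`
  have h1 : PowerSeries.map φ Z *
      ((1 - PowerSeries.X) * (1 - PowerSeries.C (q : ℂ) * PowerSeries.X)) = (A : ℂ⟦X⟧) := by
    have h := congrArg (PowerSeries.map φ) (mul_eq_of_isWeilFactorization_one hW)
    rw [hAc] at h
    simpa using h
  have hB1 : PowerSeries.constantCoeff (1 - PowerSeries.X : ℂ⟦X⟧) ≠ 0 := by simp
  have hB2 : PowerSeries.constantCoeff (1 - PowerSeries.C (q : ℂ) * PowerSeries.X) ≠ 0 := by simp
  have hB : PowerSeries.constantCoeff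
      ((1 - PowerSeries.X) * (1 - PowerSeries.C (q : ℂ) * PowerSeries.X)) ≠ 0 := by simp
  have hZ0 : PowerSeries.constantCoeff (PowerSeries.map φ Z) ≠ 0 := by
    have h := congrArg PowerSeries.constantCoeff h1
    simp only [map_mul, map_sub, map_one, PowerSeries.constantCoeff_X, sub_zero, mul_one,
      PowerSeries.constantCoeff_C, mul_zero, Polynomial.constantCoeff_coe, hA0] at h
    rw [h]
    exact one_ne_zero
  -- `(Z_ℂ)' = Z_ℂ · D_ℂ`
  have h2 : d⁄dX ℂ (PowerSeries.map φ Z) = PowerSeries.map φ Z * PowerSeries.map φ D := by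
    rw [derivative_map, hD, map_mul]
  -- logarithmic derivatives of both sides of `h1`, coefficient of `Tⁿ`
  have h3 := congrArg (fun f => PowerSeries.coeff n (d⁄dX ℂ f * f⁻¹)) h1
  rw [derivative_mul_mul_inv hZ0 hB, derivative_mul_mul_inv hB1 hB2, h2,
    mul_right_comm, PowerSeries.mul_inv_cancel _ hZ0, one_mul, map_add, map_add,
    coeff_derivative_one_sub_X_mul_inv, coeff_derivative_one_sub_C_mul_X_mul_inv,
    coeff_derivative_coe_mul_inv (IsAlgClosed.splits A) (by rw [hA0]; exact one_ne_zero),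
    PowerSeries.coeff_map, hφ, eq_ratCast] at h3
  linear_combination h3

/-- The estimate (Hartshorne, App. C, Ex. 5.7 (b), easy direction): if every complex root `z` of
`A` has `|z| = q^{-1/2}`, then `|∑_z z^{-(n+1)}| ≤ deg A · q^{(n+1)/2}` (sum over the roots of `A`
with multiplicity, of which there are `deg A` by the fundamental theorem of algebra).
[cite: Hartshorne1977, App. C, Ex. 5.7(b)] -/
theorem norm_sum_roots_le {q : ℕ} {A : ℂ[X]}
    (hRH : ∀ z : ℂ, A.IsRoot z → ‖z‖ = (q : ℝ) ^ (-(1 : ℝ) / 2)) (n : ℕ) :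
    ‖(A.roots.map fun z => z⁻¹ ^ (n + 1)).sum‖ ≤
      A.natDegree * (q : ℝ) ^ (((n + 1 : ℕ) : ℝ) / 2) := by
  by_cases hA : A = 0
  · subst hA
    simp
  have hq0 : (0 : ℝ) ≤ q := Nat.cast_nonneg q
  calc ‖(A.roots.map fun z => z⁻¹ ^ (n + 1)).sum‖
      ≤ (A.roots.map fun z => ‖z⁻¹ ^ (n + 1)‖).sum := by
        simpa [Multiset.map_map] using norm_multiset_sum_le (A.roots.map fun z => z⁻¹ ^ (n + 1))
    _ = (A.roots.map fun _ => (q : ℝ) ^ (((n + 1 : ℕ) : ℝ) / 2)).sum := by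
        refine congr_arg _ (Multiset.map_congr rfl fun z hz => ?_)
        have h := hRH z ((mem_roots hA).mp hz)
        rw [norm_pow, norm_inv, h, neg_div, Real.rpow_neg hq0, inv_inv, ← Real.rpow_natCast,
          ← Real.rpow_mul hq0]
        congr 1
        push_cast
        ring
    _ = A.roots.card * (q : ℝ) ^ (((n + 1 : ℕ) : ℝ) / 2) := by
        rw [Multiset.map_const', Multiset.sum_replicate, nsmul_eq_mul]
    _ = A.natDegree * (q : ℝ) ^ (((n + 1 : ℕ) : ℝ) / 2) := by
        rw [(IsAlgClosed.splits A).natDegree_eq_card_roots]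

end HasseWeil

/-! ### The zeta function of a scheme and the discharge -/

section HasseWeilBound

open scoped PowerSeries

variable {k : Type u} [Field k] [Finite k]

/-- `Z(X, T)' = Z(X, T) · (log Z(X, T))'` in `ℚ⟦T⟧`: the chain rule for `Z = exp ∘ L`
(Mathlib `PowerSeries.derivative_subst`, `PowerSeries.derivative_exp`; Hartshorne, App. C §1).
[folklore] -/
theorem derivative_zetaSeries (X : Literature.AlgebraicGeometry.Motives.SchemeOver k) :
    d⁄dX ℚ (Literature.AlgebraicGeometry.Motives.zetaSeries X) = Literature.AlgebraicGeometry.Motives.zetaSeries X * d⁄dX ℚ (Literature.AlgebraicGeometry.Motives.logZetaSeries X) := by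
  rw [Literature.AlgebraicGeometry.Motives.zetaSeries, PowerSeries.derivative_subst ℚ (Literature.AlgebraicGeometry.Motives.hasSubst_logZetaSeries X),
    PowerSeries.derivative_exp]

/-- `[Tⁿ] (log Z(X, T))' = N_{n+1}`: the derivative of `∑_{m ≥ 1} N_m Tᵐ / m` is `∑ₙ N_{n+1} Tⁿ`
(Hartshorne, App. C §1). [folklore] -/
theorem coeff_derivative_logZetaSeries (X : Literature.AlgebraicGeometry.Motives.SchemeOver k) (n : ℕ) :
    PowerSeries.coeff n (d⁄dX ℚ (Literature.AlgebraicGeometry.Motives.logZetaSeries X)) = Literature.AlgebraicGeometry.Motives.pointCount X (n + 1) := by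
  rw [PowerSeries.coeff_derivative, Literature.AlgebraicGeometry.Motives.coeff_logZetaSeries, if_neg n.succ_ne_zero]
  push_cast
  field_simp

/-- **Discharge of `abs_pointCount_sub_le_of_curve`** (Hasse–Weil bound for curves, conditional
form: Weil, *Sur les courbes algébriques et les variétés qui s'en déduisent* (1948), for the
theorem itself; Hartshorne, *Algebraic Geometry*, App. C, Ex. 5.7 (a), (b) for this implication).
Given a Weil factorization `Z(X, T) = P₁(T)/((1 - T)(1 - qT))` whose `P₁` satisfies the Riemann
hypothesis, `|#X(𝔽_{q^m}) - qᵐ - 1| ≤ deg P₁ · q^{m/2}` for all `m ≥ 1`. Proof: logarithmic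
derivative of `Z = exp (∑ N_m Tᵐ/m)` in `ℂ⟦T⟧` (`HasseWeil.coeff_sub_eq_neg_sum_roots`) and the
triangle inequality (`HasseWeil.norm_sum_roots_le`); the smoothness hypothesis is not used.
[cite: Hartshorne1977, App. C, Ex. 5.7] [cite: Weil1948] -/
theorem abs_pointCount_sub_le_of_curve_holds : abs_pointCount_sub_le_of_curve (k := k) := by
  intro X _ P hW m hm
  obtain ⟨n, rfl⟩ : ∃ n, m = n + 1 := ⟨m - 1, by omega⟩
  have key := HasseWeil.coeff_sub_eq_neg_sum_roots hW (derivative_zetaSeries X) n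
  rw [coeff_derivative_logZetaSeries, Rat.cast_natCast] at key
  have hRH : ∀ z : ℂ, ((P 1).map (Int.castRingHom ℂ)).IsRoot z →
      ‖z‖ = (Nat.card k : ℝ) ^ (-(1 : ℝ) / 2) := fun z hz => by
    have h := hW.2.2.2.2 1 z hz
    rwa [show ((1 : Fin (2 * 1 + 1)) : ℕ) = 1 from rfl, Nat.cast_one] at h
  have hdeg : ((P 1).map (Int.castRingHom ℂ)).natDegree = (P 1).natDegree :=
    natDegree_map_eq_of_injective (Int.castRingHom ℂ).injective_int _
  have hle := HasseWeil.norm_sum_roots_le hRH n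
  rw [hdeg, ← norm_neg, ← key] at hle
  have hcast : (((Literature.AlgebraicGeometry.Motives.pointCount X (n + 1) : ℝ) - (Nat.card k : ℝ) ^ (n + 1) - 1 : ℝ) : ℂ) =
      (Literature.AlgebraicGeometry.Motives.pointCount X (n + 1) : ℂ) - (Nat.card k : ℂ) ^ (n + 1) - 1 := by
    push_cast
    ring
  rw [← Real.norm_eq_abs, ← Complex.norm_real, hcast]
  exact hle

end HasseWeilBound

end RH

end Literature.NumberTheory.LFunctions

end
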